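import Literature.Analysis.FluidPDE.DuchonRobertCubicIdentity
import Literature.Analysis.FluidPDE.LerayResolvedEnergyDistributional
import HarnessLib

/-!
# Duchon–Robert's viscous term at a fixed time: moving the Laplacian of the symmetric test field onto the weak gradient

Analysis/FluidPDE support file for the discharge of `Torus.tendsto_viscous_pairing`
(`Literature.Analysis.FluidPDE.DuchonRobertLocalBalance`; Duchon–Robert 2000, proof of Prop. 1,
p. 251: the viscous terms `νΔ(u·u^ε)` and `ν ∇u : ∇u^ε`). At a fixed time, for an integrable field
`v : T^d → ℝ^d` with an integrable weak gradient `G` (`Torus.HasWeakGradient`, Evans §5.2.1), a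
smooth even kernel `K` and a smooth cut-off `χ`, the Laplacian of the symmetric test field
`Φ = χ (v ⋆ K) + (χ v) ⋆ K` (`Torus.symmTestField`) pairs with `v` as

`∫ ⟪v, ΔΦ⟫ = ∑ᵢ ∫ Δχ vᵢ (vᵢ ⋆ K) − 2 ∑ⱼ ∑ᵢ ∫ χ (G eⱼ)ᵢ ((G eⱼ)ᵢ ⋆ K)`

(`Torus.integral_inner_laplacian_symmTestField`) — the weak form of
"`Δ(u·u^ε) − 2 ∇u:∇u^ε`", with `∇(u ⋆ K) = (∇u) ⋆ K`. Everything is proved, componentwise and with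
scalar calculus only:

* `Torus.HasWeakGradient.integral_partialDeriv_mul_apply` — the component form
  `∫ ∂ⱼθ vᵢ = −∫ θ (G eⱼ)ᵢ` of the weak-gradient identity (Evans, §5.2.1);
* `Torus.HasWeakGradient.partialDeriv_convolution_apply` — `∂ⱼ(vᵢ ⋆ K) = (G eⱼ)ᵢ ⋆ K` (Evans,
  §5.3.1, Thm. 1, step 1: test the identity with `K(x − ·)`);
* `Torus.laplacian_mul`, `Torus.laplacian_add` — Leibniz rule `Δ(ab) = Δa b + 2∑ⱼ ∂ⱼa ∂ⱼb + a Δb`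
  and additivity for the torus Laplacian;
* `Torus.integral_apply_mul_laplacian_eq` — one component of the identity: Leibniz, then
  `Δ((χvᵢ) ⋆ K) = (χvᵢ) ⋆ ΔK` paired back onto `vᵢ ⋆ ΔK = Δ(vᵢ ⋆ K)` by the symmetry of `⋆ K`
  (`Torus.integral_mul_convolution_comm`, `ΔK` even), then the weak-gradient identity tested with
  `χ ∂ⱼ(vᵢ ⋆ K)`; the `∂ⱼχ`-terms cancel;
* `Torus.integral_inner_laplacian_symmTestField` — the vector form (`Torus.laplacian_apply_eq`,
  `PiLp.inner_apply`; smoothness of `Φ` and its components from the sibling discharge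
  `DuchonRobertCubicIdentity`: `Torus.isSmooth_symmTestField`, `Torus.symmTestField_apply_apply`).

## References

* J. Duchon, R. Robert, *Inertial energy dissipation for weak solutions of incompressible Euler
  and Navier–Stokes equations*, Nonlinearity 13 (2000) 249–255, proof of Prop. 1, p. 251. [DuchonRobert2000]
* L. C. Evans, *Partial Differential Equations*, 2nd ed. (2010), §5.2.1 (weak derivatives),
  §5.3.1 Thm. 1 (derivatives of mollifications of Sobolev functions), App. C.4 Thm. 7. [Evans2010]

## Tree search

Used: `Torus.partialDeriv_convolution`, `Torus.laplacian_convolution`, `Torus.isSmooth_convolution`,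
`Torus.partialDeriv_comp_sub_left`, `Torus.laplacian_comp_sub_left` (`TorusConvolution`),
`Torus.integral_mul_convolution_comm` (`TorusSpaceTimeConvolution`),
`Torus.laplacian_eq_sum_partialDeriv_partialDeriv`, `Torus.partialDeriv_mul`, `Torus.partialDeriv_add`
(`TorusCalculusProofs`, `TorusTestFunction`), `Torus.laplacian_apply_eq`
(`LerayResolvedEnergyDistributional`), `eval_integral_piLp` (Mathlib). No torus Leibniz rule for
`Δ` of a product and no weak-derivative-of-mollification lemma existed (searched `laplacian_mul`,
`HasWeakPartialDeriv` + `convolution`).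
-/

noncomputable section

open MeasureTheory TopologicalSpace Set Function Filter Topology Metric
open scoped ENNReal NNReal Convolution ContDiff InnerProductSpace RealInnerProductSpace

namespace Literature.Analysis.FluidPDE.Torus

variable {d : Type*} [Fintype d] [DecidableEq d]

/-! ## Weak gradients: component form and mollification -/

section WeakGrad

variable {v : UnitAddTorus d → EuclideanSpace ℝ d}
  {Gt : UnitAddTorus d → EuclideanSpace ℝ d →L[ℝ] EuclideanSpace ℝ d}

/-- **Component form of a weak gradient**: if `G` is an integrable weak gradient of the
integrable field `v`, then for every smooth scalar `θ` and all `j, i`,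
`∫ ∂ⱼθ vᵢ = -∫ θ (G eⱼ)ᵢ` (the `i`-th coordinate of the vector identity
`Torus.HasWeakPartialDeriv j v (G · eⱼ)`; Evans, §5.2.1). [folklore] -/
theorem HasWeakGradient.integral_partialDeriv_mul_apply (hG : HasWeakGradient v Gt)
    (hv : Integrable v volume) (hGi : Integrable Gt volume) {θ : UnitAddTorus d → ℝ}
    (hθ : FunctionSpaces.Torus.IsSmooth θ) (j i : d) :
    ∫ x, FunctionSpaces.Torus.partialDeriv j θ x * v x i =
      -∫ x, θ x * Gt x (EuclideanSpace.single j 1) i := by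
  have h := hG j θ hθ
  have hGj : Integrable (fun x => Gt x (EuclideanSpace.single j 1)) volume :=
    (ContinuousLinearMap.apply ℝ (EuclideanSpace ℝ d) (EuclideanSpace.single j 1)).integrable_comp hGi
  have hi1 : Integrable (fun x => FunctionSpaces.Torus.partialDeriv j θ x • v x) volume :=
    (hθ.partialDeriv j).integrable_smul hv
  have hi2 : Integrable (fun x => θ x • Gt x (EuclideanSpace.single j 1)) volume :=
    hθ.integrable_smul hGj
  have h1 := congrArg (fun w : EuclideanSpace ℝ d => w i) h
  simp only at h1
  rw [eval_integral_piLp (fun i => hi1.eval_piLp i) i, PiLp.neg_apply,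
    eval_integral_piLp (fun i => hi2.eval_piLp i) i] at h1
  simpa only [PiLp.smul_apply, smul_eq_mul] using h1

/-- **Weak derivatives of a mollification** (Evans, §5.3.1, Thm. 1, step 1: `∂ⱼ(v ⋆ K) = (∂ⱼv) ⋆ K`
for the weak derivative): if `G` is an integrable weak gradient of the integrable field `v` and
`K` is a smooth kernel, then `∂ⱼ(vᵢ ⋆ K) = (G eⱼ)ᵢ ⋆ K` pointwise (test the weak-derivative
identity with the smooth function `K(x - ·)`). [folklore] -/
theorem HasWeakGradient.partialDeriv_convolution_apply (hG : HasWeakGradient v Gt)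
    (hv : Integrable v volume) (hGi : Integrable Gt volume) {K : UnitAddTorus d → ℝ}
    (hK : FunctionSpaces.Torus.IsSmooth K) (j i : d) (x : UnitAddTorus d) :
    FunctionSpaces.Torus.partialDeriv j ((fun y => v y i) ⋆ K) x =
      ((fun y => Gt y (EuclideanSpace.single j 1) i) ⋆ K) x := by
  have hvi : Integrable (fun y => v y i) volume := hv.eval_piLp i
  rw [FunctionSpaces.Torus.partialDeriv_convolution hvi hK, convolution_lsmul, convolution_lsmul]
  simp only [smul_eq_mul]
  have hθ : FunctionSpaces.Torus.IsSmooth (fun y => K (x - y)) := hK.comp_sub_left x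
  have h1 := hG.integral_partialDeriv_mul_apply hv hGi hθ j i
  have h2 : ∀ y, FunctionSpaces.Torus.partialDeriv j (fun y => K (x - y)) y =
      -FunctionSpaces.Torus.partialDeriv j K (x - y) :=
    FunctionSpaces.Torus.partialDeriv_comp_sub_left (hK.isContDiff (by simp)) j x
  simp_rw [h2, neg_mul, integral_neg, neg_inj] at h1
  calc ∫ y, v y i * FunctionSpaces.Torus.partialDeriv j K (x - y)
      = ∫ y, FunctionSpaces.Torus.partialDeriv j K (x - y) * v y i := by simp_rw [mul_comm]
    _ = ∫ y, K (x - y) * Gt y (EuclideanSpace.single j 1) i := h1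
    _ = ∫ y, Gt y (EuclideanSpace.single j 1) i * K (x - y) := by simp_rw [mul_comm]

end WeakGrad

/-! ## Scalar calculus on the torus: the Laplacian of a product -/

section Calculus

/-- **Leibniz rule for the Laplacian of a product of smooth scalar functions on `T^d`**:
`Δ(ab) = (Δa) b + 2 ∑ⱼ ∂ⱼa ∂ⱼb + a Δb`. [folklore] -/
theorem laplacian_mul {a b : UnitAddTorus d → ℝ} (ha : FunctionSpaces.Torus.IsSmooth a)
    (hb : FunctionSpaces.Torus.IsSmooth b) (x : UnitAddTorus d) :
    FunctionSpaces.Torus.laplacian (fun y => a y * b y) x =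
      FunctionSpaces.Torus.laplacian a x * b x +
        2 * ∑ j, FunctionSpaces.Torus.partialDeriv j a x * FunctionSpaces.Torus.partialDeriv j b x +
        a x * FunctionSpaces.Torus.laplacian b x := by
  have hab : FunctionSpaces.Torus.IsSmooth (fun y => a y * b y) :=
    (ContDiff.mul ha hb : FunctionSpaces.Torus.IsSmooth fun y => a y * b y)
  have ha1 : FunctionSpaces.Torus.IsContDiff 1 a := ha.isContDiff (by simp)
  have hb1 : FunctionSpaces.Torus.IsContDiff 1 b := hb.isContDiff (by simp)
  have hda1 : ∀ j, FunctionSpaces.Torus.IsContDiff 1 (FunctionSpaces.Torus.partialDeriv j a) :=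
    fun j => (ha.partialDeriv j).isContDiff (by simp)
  have hdb1 : ∀ j, FunctionSpaces.Torus.IsContDiff 1 (FunctionSpaces.Torus.partialDeriv j b) :=
    fun j => (hb.partialDeriv j).isContDiff (by simp)
  rw [FunctionSpaces.Torus.laplacian_eq_sum_partialDeriv_partialDeriv hab,
    FunctionSpaces.Torus.laplacian_eq_sum_partialDeriv_partialDeriv ha,
    FunctionSpaces.Torus.laplacian_eq_sum_partialDeriv_partialDeriv hb, Finset.sum_mul,
    Finset.mul_sum, Finset.mul_sum, ← Finset.sum_add_distrib, ← Finset.sum_add_distrib]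
  refine Finset.sum_congr rfl fun j _ => ?_
  have h1 : FunctionSpaces.Torus.partialDeriv j (fun y => a y * b y) =
      fun y => a y * FunctionSpaces.Torus.partialDeriv j b y +
        FunctionSpaces.Torus.partialDeriv j a y * b y :=
    funext fun y => FunctionSpaces.Torus.partialDeriv_mul ha1 hb1 j y
  have hs1 : FunctionSpaces.Torus.IsContDiff 1 (fun y => a y * FunctionSpaces.Torus.partialDeriv j b y) :=
    ContDiff.mul ha1 (hdb1 j)
  have hs2 : FunctionSpaces.Torus.IsContDiff 1 (fun y => FunctionSpaces.Torus.partialDeriv j a y * b y) :=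
    ContDiff.mul (hda1 j) hb1
  have h2 : (fun y => a y * FunctionSpaces.Torus.partialDeriv j b y +
      FunctionSpaces.Torus.partialDeriv j a y * b y) =
      (fun y => a y * FunctionSpaces.Torus.partialDeriv j b y) +
        fun y => FunctionSpaces.Torus.partialDeriv j a y * b y := rfl
  rw [h1, h2, FunctionSpaces.Torus.partialDeriv_add hs1 hs2, Pi.add_apply,
    FunctionSpaces.Torus.partialDeriv_mul ha1 (hdb1 j), FunctionSpaces.Torus.partialDeriv_mul (hda1 j) hb1]
  ring

end Calculus

/-! ## The viscous pairing at a fixed time: moving the Laplacian onto the weak gradient -/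

section Slice

variable {v : UnitAddTorus d → EuclideanSpace ℝ d}
  {Gt : UnitAddTorus d → EuclideanSpace ℝ d →L[ℝ] EuclideanSpace ℝ d}
  {K χ : UnitAddTorus d → ℝ}

omit [DecidableEq d] in
/-- Products of an integrable and a smooth real function on `T^d` are integrable. [folklore] -/
theorem integrable_mul_of_isSmooth {f s : UnitAddTorus d → ℝ} (hf : Integrable f volume)
    (hs : FunctionSpaces.Torus.IsSmooth s) : Integrable (fun x => f x * s x) volume :=
  hf.mul_of_top_left (hs.memLp ⊤)

omit [DecidableEq d] in
/-- The Laplacian of an even smooth kernel is even. [folklore] -/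
theorem laplacian_neg_of_even (hK : FunctionSpaces.Torus.IsSmooth K) (hKev : ∀ z, K (-z) = K z)
    (z : UnitAddTorus d) :
    FunctionSpaces.Torus.laplacian K (-z) = FunctionSpaces.Torus.laplacian K z := by
  have h := FunctionSpaces.Torus.laplacian_comp_sub_left hK 0 z
  have hfun : (fun y => K (0 - y)) = K := funext fun y => by rw [zero_sub, hKev]
  rw [hfun, zero_sub] at h
  exact h.symm

/-- **One component of the viscous pairing** (Duchon–Robert 2000, proof of Prop. 1, p. 251, the
viscous terms; Evans, §5.2.1): for an integrable field `v` with integrable weak gradient `G`, a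
smooth even kernel `K` and a smooth cut-off `χ`, with `wᵢ = vᵢ ⋆ K`,
`∫ vᵢ [Δ(χ wᵢ) + Δ((χvᵢ) ⋆ K)] = ∫ Δχ vᵢ wᵢ − 2 ∑ⱼ ∫ χ (G eⱼ)ᵢ ((G eⱼ)ᵢ ⋆ K)`
(Leibniz rule for `Δ(χwᵢ)`, `Δ((χvᵢ) ⋆ K) = (χvᵢ) ⋆ ΔK` paired back onto `vᵢ ⋆ ΔK = Δwᵢ` by the
symmetry of `⋆ K`, then `∫ χ vᵢ ∂ⱼ∂ⱼwᵢ = −∫ χ ∂ⱼwᵢ (G eⱼ)ᵢ − ∫ ∂ⱼχ ∂ⱼwᵢ vᵢ` by the weak-gradient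
identity tested with `χ ∂ⱼwᵢ`, and `∂ⱼwᵢ = (G eⱼ)ᵢ ⋆ K`). [folklore] -/
theorem integral_apply_mul_laplacian_eq (hv : Integrable v volume) (hG : HasWeakGradient v Gt)
    (hGi : Integrable Gt volume) (hK : FunctionSpaces.Torus.IsSmooth K) (hKev : ∀ z, K (-z) = K z)
    (hχ : FunctionSpaces.Torus.IsSmooth χ) (i : d) :
    ∫ x, v x i * (FunctionSpaces.Torus.laplacian (fun y => χ y * ((fun y => v y i) ⋆ K) y) x +
        FunctionSpaces.Torus.laplacian ((fun y => χ y * v y i) ⋆ K) x) =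
      (∫ x, FunctionSpaces.Torus.laplacian χ x * (v x i * ((fun y => v y i) ⋆ K) x)) -
        2 * ∑ j, ∫ x, χ x * (Gt x (EuclideanSpace.single j 1) i *
          ((fun y => Gt y (EuclideanSpace.single j 1) i) ⋆ K) x) := by
  -- notation
  set vi : UnitAddTorus d → ℝ := fun y => v y i with hvi_def
  set w : UnitAddTorus d → ℝ := vi ⋆ K with hw_def
  set g : d → UnitAddTorus d → ℝ := fun j y => Gt y (EuclideanSpace.single j 1) i with hg_def
  have hvi : Integrable vi volume := hv.eval_piLp i
  have hχvi : Integrable (fun y => χ y * vi y) volume := hχ.integrable_smul hvi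
  have hgj : ∀ j, Integrable (g j) volume := fun j =>
    ((ContinuousLinearMap.apply ℝ (EuclideanSpace ℝ d) (EuclideanSpace.single j 1)).integrable_comp
      hGi).eval_piLp i
  have hw : FunctionSpaces.Torus.IsSmooth w := FunctionSpaces.Torus.isSmooth_convolution hvi hK
  have hgK : ∀ j, FunctionSpaces.Torus.IsSmooth (g j ⋆ K) := fun j =>
    FunctionSpaces.Torus.isSmooth_convolution (hgj j) hK
  have hχ1 : FunctionSpaces.Torus.IsContDiff 1 χ := hχ.isContDiff (by simp)
  have hdw : ∀ j, FunctionSpaces.Torus.IsSmooth (FunctionSpaces.Torus.partialDeriv j w) :=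
    fun j => hw.partialDeriv j
  have hdw1 : ∀ j, FunctionSpaces.Torus.IsContDiff 1 (FunctionSpaces.Torus.partialDeriv j w) :=
    fun j => (hdw j).isContDiff (by simp)
  -- the calculus facts
  have hL1 : ∀ x, FunctionSpaces.Torus.laplacian (fun y => χ y * w y) x =
      FunctionSpaces.Torus.laplacian χ x * w x +
        2 * ∑ j, FunctionSpaces.Torus.partialDeriv j χ x * FunctionSpaces.Torus.partialDeriv j w x +
        χ x * FunctionSpaces.Torus.laplacian w x := laplacian_mul hχ hw
  have hL2 : ∀ x, FunctionSpaces.Torus.laplacian ((fun y => χ y * vi y) ⋆ K) x =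
      ((fun y => χ y * vi y) ⋆ FunctionSpaces.Torus.laplacian K) x :=
    FunctionSpaces.Torus.laplacian_convolution hχvi hK
  have hL3 : ∀ x, FunctionSpaces.Torus.laplacian w x = (vi ⋆ FunctionSpaces.Torus.laplacian K) x :=
    FunctionSpaces.Torus.laplacian_convolution hvi hK
  have hL4 : ∀ x, FunctionSpaces.Torus.laplacian w x =
      ∑ j, FunctionSpaces.Torus.partialDeriv j (FunctionSpaces.Torus.partialDeriv j w) x :=
    FunctionSpaces.Torus.laplacian_eq_sum_partialDeriv_partialDeriv hw
  have hD : ∀ j x, FunctionSpaces.Torus.partialDeriv j w x = (g j ⋆ K) x := fun j x =>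
    hG.partialDeriv_convolution_apply hv hGi hK j i x
  have hadj : ∫ x, vi x * ((fun y => χ y * vi y) ⋆ FunctionSpaces.Torus.laplacian K) x =
      ∫ x, (vi ⋆ FunctionSpaces.Torus.laplacian K) x * (χ x * vi x) :=
    FunctionSpaces.Torus.integral_mul_convolution_comm hvi hχvi hK.laplacian.continuous
      (laplacian_neg_of_even hK hKev)
  have hIBP : ∀ j, ∫ x, FunctionSpaces.Torus.partialDeriv j
      (fun y => χ y * FunctionSpaces.Torus.partialDeriv j w y) x * vi x =
        -∫ x, (χ x * FunctionSpaces.Torus.partialDeriv j w x) * g j x := fun j =>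
    hG.integral_partialDeriv_mul_apply hv hGi (hχ.smul' (hdw j)) j i
  have hPm : ∀ j x, FunctionSpaces.Torus.partialDeriv j
      (fun y => χ y * FunctionSpaces.Torus.partialDeriv j w y) x =
        χ x * FunctionSpaces.Torus.partialDeriv j (FunctionSpaces.Torus.partialDeriv j w) x +
          FunctionSpaces.Torus.partialDeriv j χ x * FunctionSpaces.Torus.partialDeriv j w x :=
    fun j x => FunctionSpaces.Torus.partialDeriv_mul hχ1 (hdw1 j) j x
  -- the integrals
  set A : ℝ := ∫ x, FunctionSpaces.Torus.laplacian χ x * (vi x * w x) with hA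
  set B : d → ℝ := fun j => ∫ x, FunctionSpaces.Torus.partialDeriv j χ x *
    (vi x * FunctionSpaces.Torus.partialDeriv j w x) with hB
  set C : ℝ := ∫ x, χ x * (vi x * FunctionSpaces.Torus.laplacian w x) with hC
  set D : d → ℝ := fun j => ∫ x, χ x * (g j x * FunctionSpaces.Torus.partialDeriv j w x) with hD_def
  -- integrability of the pieces
  have iA : Integrable (fun x => FunctionSpaces.Torus.laplacian χ x * (vi x * w x)) volume :=
    hχ.laplacian.integrable_smul (integrable_mul_of_isSmooth hvi hw)
  have iB : ∀ j, Integrable (fun x => FunctionSpaces.Torus.partialDeriv j χ x *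
      (vi x * FunctionSpaces.Torus.partialDeriv j w x)) volume := fun j =>
    (hχ.partialDeriv j).integrable_smul (integrable_mul_of_isSmooth hvi (hdw j))
  have iC : Integrable (fun x => χ x * (vi x * FunctionSpaces.Torus.laplacian w x)) volume :=
    hχ.integrable_smul (integrable_mul_of_isSmooth hvi hw.laplacian)
  have iC' : ∀ j, Integrable (fun x => χ x *
      (vi x * FunctionSpaces.Torus.partialDeriv j (FunctionSpaces.Torus.partialDeriv j w) x)) volume :=
    fun j => hχ.integrable_smul (integrable_mul_of_isSmooth hvi ((hdw j).partialDeriv j))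
  have iD : ∀ j, Integrable (fun x => χ x * (g j x * FunctionSpaces.Torus.partialDeriv j w x)) volume :=
    fun j => hχ.integrable_smul (integrable_mul_of_isSmooth (hgj j) (hdw j))
  -- (1) the product term
  have h1 : ∫ x, vi x * FunctionSpaces.Torus.laplacian (fun y => χ y * w y) x =
      A + 2 * ∑ j, B j + C := by
    have hpt : ∀ x, vi x * FunctionSpaces.Torus.laplacian (fun y => χ y * w y) x =
        FunctionSpaces.Torus.laplacian χ x * (vi x * w x) +
          2 * ∑ j, FunctionSpaces.Torus.partialDeriv j χ x *
            (vi x * FunctionSpaces.Torus.partialDeriv j w x) +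
          χ x * (vi x * FunctionSpaces.Torus.laplacian w x) := fun x => by
      rw [hL1, Finset.mul_sum, Finset.mul_sum]
      simp only [mul_add, Finset.mul_sum]
      congr 1
      · congr 1
        · ring
        · exact Finset.sum_congr rfl fun j _ => by ring
      · ring
    simp_rw [hpt]
    have iBs : Integrable (fun x => ∑ j, FunctionSpaces.Torus.partialDeriv j χ x *
        (vi x * FunctionSpaces.Torus.partialDeriv j w x)) volume :=
      integrable_finsetSum _ fun j _ => iB j
    have iBs2 : Integrable (fun x => 2 * ∑ j, FunctionSpaces.Torus.partialDeriv j χ x *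
        (vi x * FunctionSpaces.Torus.partialDeriv j w x)) volume := iBs.const_mul 2
    have iABs : Integrable (fun x => FunctionSpaces.Torus.laplacian χ x * (vi x * w x) +
        2 * ∑ j, FunctionSpaces.Torus.partialDeriv j χ x *
          (vi x * FunctionSpaces.Torus.partialDeriv j w x)) volume := iA.add iBs2
    rw [integral_add iABs iC, integral_add iA iBs2, integral_const_mul,
      integral_finsetSum _ fun j _ => iB j]
  -- (2) the mollified term, by symmetry of `⋆ K`
  have h2 : ∫ x, vi x * FunctionSpaces.Torus.laplacian ((fun y => χ y * vi y) ⋆ K) x = C := by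
    simp_rw [hL2]
    rw [hadj, hC]
    refine integral_congr_ae (ae_of_all _ fun x => ?_)
    dsimp only
    rw [← hL3]
    ring
  -- (3) the weak-gradient integration by parts
  have h3 : C = -∑ j, D j - ∑ j, B j := by
    have hC' : C = ∑ j, ∫ x, χ x *
        (vi x * FunctionSpaces.Torus.partialDeriv j (FunctionSpaces.Torus.partialDeriv j w) x) := by
      rw [hC, ← integral_finsetSum _ fun j _ => iC' j]
      refine integral_congr_ae (ae_of_all _ fun x => ?_)
      dsimp only
      rw [hL4, Finset.mul_sum, Finset.mul_sum]
    rw [hC', ← Finset.sum_neg_distrib, ← Finset.sum_sub_distrib]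
    refine Finset.sum_congr rfl fun j _ => ?_
    have hj := hIBP j
    simp_rw [hPm j] at hj
    have hsplit : ∫ x, (χ x * FunctionSpaces.Torus.partialDeriv j (FunctionSpaces.Torus.partialDeriv j w) x +
        FunctionSpaces.Torus.partialDeriv j χ x * FunctionSpaces.Torus.partialDeriv j w x) * vi x =
        (∫ x, χ x * (vi x * FunctionSpaces.Torus.partialDeriv j (FunctionSpaces.Torus.partialDeriv j w) x)) +
          B j := by
      rw [hB, ← integral_add (iC' j) (iB j)]
      refine integral_congr_ae (ae_of_all _ fun x => ?_)
      dsimp only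
      ring
    have hDj : ∫ x, (χ x * FunctionSpaces.Torus.partialDeriv j w x) * g j x = D j := by
      rw [hD_def]
      refine integral_congr_ae (ae_of_all _ fun x => ?_)
      dsimp only
      ring
    rw [hsplit, hDj] at hj
    linarith
  -- (4) `∂ⱼ w = (G eⱼ)ᵢ ⋆ K`
  have h4 : ∀ j, D j = ∫ x, χ x * (g j x * (g j ⋆ K) x) := fun j => by
    rw [hD_def]
    refine integral_congr_ae (ae_of_all _ fun x => ?_)
    dsimp only
    rw [hD j x]
  -- conclusion
  have iF : Integrable (fun x => vi x * FunctionSpaces.Torus.laplacian (fun y => χ y * w y) x) volume :=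
    integrable_mul_of_isSmooth hvi (hχ.smul' hw).laplacian
  have iH : Integrable (fun x => vi x *
      FunctionSpaces.Torus.laplacian ((fun y => χ y * vi y) ⋆ K) x) volume :=
    integrable_mul_of_isSmooth hvi (FunctionSpaces.Torus.isSmooth_convolution hχvi hK).laplacian
  calc ∫ x, vi x * (FunctionSpaces.Torus.laplacian (fun y => χ y * w y) x +
        FunctionSpaces.Torus.laplacian ((fun y => χ y * vi y) ⋆ K) x)
      = (∫ x, vi x * FunctionSpaces.Torus.laplacian (fun y => χ y * w y) x) +
          ∫ x, vi x * FunctionSpaces.Torus.laplacian ((fun y => χ y * vi y) ⋆ K) x := by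
        rw [← integral_add iF iH]
        exact integral_congr_ae (ae_of_all _ fun x => by dsimp only; ring)
    _ = A + 2 * ∑ j, B j + C + C := by rw [h1, h2]
    _ = A - 2 * ∑ j, D j := by
        rw [h3, Finset.mul_sum, Finset.mul_sum]
        have : ∀ s₁ s₂ : ℝ, A + 2 * s₁ + (-s₂ - s₁) + (-s₂ - s₁) = A - 2 * s₂ := fun s₁ s₂ => by ring
        simpa [Finset.mul_sum] using this (∑ j, B j) (∑ j, D j)
    _ = A - 2 * ∑ j, ∫ x, χ x * (g j x * (g j ⋆ K) x) := by
        rw [Finset.sum_congr rfl fun j _ => h4 j]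

end Slice

/-! ## The viscous pairing at a fixed time: vector form -/

section SliceVec

variable {v : UnitAddTorus d → EuclideanSpace ℝ d}
  {Gt : UnitAddTorus d → EuclideanSpace ℝ d →L[ℝ] EuclideanSpace ℝ d}
  {K χ : UnitAddTorus d → ℝ}

omit [DecidableEq d] in
/-- **Additivity of the torus Laplacian** for smooth functions (Mathlib's
`ContDiffAt.laplacian_add` on the re-centred lifts). [folklore] -/
theorem _root_.Literature.Analysis.FunctionSpaces.Torus.laplacian_add {F : Type*}
    [NormedAddCommGroup F] [NormedSpace ℝ F] {f g : UnitAddTorus d → F}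
    (hf : FunctionSpaces.Torus.IsSmooth f) (hg : FunctionSpaces.Torus.IsSmooth g)
    (x : UnitAddTorus d) :
    FunctionSpaces.Torus.laplacian (fun y => f y + g y) x =
      FunctionSpaces.Torus.laplacian f x + FunctionSpaces.Torus.laplacian g x := by
  have h1 : ContDiffAt ℝ 2 (FunctionSpaces.Torus.liftAt f x) 0 :=
    ((hf.liftAt x).of_le (WithTop.coe_le_coe.mpr le_top)).contDiffAt
  have h2 : ContDiffAt ℝ 2 (FunctionSpaces.Torus.liftAt g x) 0 :=
    ((hg.liftAt x).of_le (WithTop.coe_le_coe.mpr le_top)).contDiffAt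
  exact h1.laplacian_add h2

/-- **The viscous pairing at a fixed time** (Duchon–Robert 2000, proof of Prop. 1, p. 251; Evans,
§5.2.1): for an integrable field `v` with integrable weak gradient `G`, a smooth even kernel `K`
and a smooth cut-off `χ`, the Laplacian of the symmetric field `Φ = χ (v ⋆ K) + (χ v) ⋆ K` pairs
with `v` as
`∫ ⟪v, ΔΦ⟫ = ∑ᵢ ∫ Δχ vᵢ (vᵢ ⋆ K) − 2 ∑ⱼ ∑ᵢ ∫ χ (G eⱼ)ᵢ ((G eⱼ)ᵢ ⋆ K)`
(componentwise `integral_apply_mul_laplacian_eq`). [folklore] -/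
theorem integral_inner_laplacian_symmTestField (hv : Integrable v volume) (hG : HasWeakGradient v Gt)
    (hGi : Integrable Gt volume) (hK : FunctionSpaces.Torus.IsSmooth K) (hKev : ∀ z, K (-z) = K z)
    (hχ : FunctionSpaces.Torus.IsSmooth χ) :
    ∫ x, ⟪v x, FunctionSpaces.Torus.laplacian (symmTestField K χ v) x⟫ =
      (∑ i, ∫ x, FunctionSpaces.Torus.laplacian χ x * (v x i * ((fun y => v y i) ⋆ K) x)) -
        2 * ∑ j, ∑ i, ∫ x, χ x * (Gt x (EuclideanSpace.single j 1) i *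
          ((fun y => Gt y (EuclideanSpace.single j 1) i) ⋆ K) x) := by
  have hΦ := isSmooth_symmTestField hK hχ hv
  have hvi : ∀ i, Integrable (fun y => v y i) volume := fun i => hv.eval_piLp i
  have hw : ∀ i, FunctionSpaces.Torus.IsSmooth ((fun y => v y i) ⋆ K) := fun i =>
    FunctionSpaces.Torus.isSmooth_convolution (hvi i) hK
  have hq : ∀ i, FunctionSpaces.Torus.IsSmooth ((fun y => χ y * v y i) ⋆ K) := fun i =>
    FunctionSpaces.Torus.isSmooth_convolution (hχ.integrable_smul (hvi i)) hK
  -- the integrand, componentwise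
  have hpt : ∀ x, ⟪v x, FunctionSpaces.Torus.laplacian (symmTestField K χ v) x⟫ =
      ∑ i, v x i * (FunctionSpaces.Torus.laplacian (fun y => χ y * ((fun y => v y i) ⋆ K) y) x +
        FunctionSpaces.Torus.laplacian ((fun y => χ y * v y i) ⋆ K) x) := fun x => by
    rw [PiLp.inner_apply]
    refine Finset.sum_congr rfl fun i _ => ?_
    rw [laplacian_apply_eq hΦ x i, funext fun y => symmTestField_apply_apply K χ v y i,
      FunctionSpaces.Torus.laplacian_add (f := fun y => χ y * ((fun y => v y i) ⋆ K) y)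
        (hχ.smul' (hw i)) (hq i)]
    simp only [RCLike.inner_apply, conj_trivial]
    ring
  simp_rw [hpt]
  have hint : ∀ i, Integrable (fun x => v x i *
      (FunctionSpaces.Torus.laplacian (fun y => χ y * ((fun y => v y i) ⋆ K) y) x +
        FunctionSpaces.Torus.laplacian ((fun y => χ y * v y i) ⋆ K) x)) volume := fun i =>
    integrable_mul_of_isSmooth (hvi i) (((hχ.smul' (hw i)).laplacian).add (hq i).laplacian)
  rw [integral_finsetSum _ fun i _ => hint i,
    Finset.sum_congr rfl fun i _ => integral_apply_mul_laplacian_eq hv hG hGi hK hKev hχ i,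
    Finset.sum_sub_distrib, ← Finset.mul_sum, Finset.sum_comm]

end SliceVec

end Literature.Analysis.FluidPDE.Torus
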